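import Summits.FinalStateConjecture.FinalStateConjecture.Theorems.EIHFluxBalanceInertialRecessionStubEndgamePath

/-!
# Route EIHFluxBalance — crux `InertialRecession`, line `sublinear-is-free-clean-window-charges`:
# the BALLISTIC DICHOTOMY for a pair (fast relative motion at large separation is ballistic forever)

Helper file for the crux `stmt-FinalStateConjecture-10166`
(`Summit.FinalStateConjecture.FinalStateConjecture.Theses.EIHFluxBalance.InertialRecession`), registered stub
`stub_cesaroEndgame` (r6; since reshape r7 `stub_pairwiseDichotomy`) of
`Cruxes/InertialRecession/Lines/sublinear_is_free_clean_window_charges.lean`.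

THE DICHOTOMY (`ballistic_dichotomy`). Let `s` (relative position, `C¹`) and `w` (relative velocity, continuous) satisfy
`ṡ − w → 0`, `‖s‖ → ∞`, and the two-body IMPULSE LAW `‖w(t₂) − w(t₁)‖ ≤ C·(∫_{t₁}^{t₂} min(‖s‖/4, c₀u)^{-3/2} du) + ζ(t₁) + ζ(t₂)`
with `ζ → 0` (this is what the abstract window law + identification give for `N = 2` along the single-hole windows
`R = min(d/4, c₀t)`). Then EITHER the pair separates linearly (`σt ≤ ‖s(t)‖` eventually) OR `w → 0`. Proof: if
`‖w(t₀)‖ = W ≥ ε` at a late time `t₀` (late: `‖s‖ ≥ A(ε, C)`, `ζ`, `ṡ − w`, `t₀^{-1/2}` small), bootstrap on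
`‖w(u) − w(t₀)‖ ≤ W/8`: the coordinate `x = ⟨s, w(t₀)/W⟩` then increases at speed `≥ W/2`, so `‖s‖ ≥ max(|x|, A)` and the
impulse received on `[t₀, u]` is at most `|C|·8√8·∫(|x|+A)^{-3/2} + |C|·2c₀^{-3/2}t₀^{-1/2} + 2 sup ζ ≤ 3W/32 < W/8`
(`integral_ballistic_le`: `≤ 8/(W√A)`), which closes the bootstrap for all `u ≥ t₀` (first-exit-time argument); hence
`x(u) ≥ x(t₀) + (W/2)(u − t₀)` and `‖s(u)‖ ≥ (W/4)u` eventually.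

References: C. Marchal, D. Saari, J. Differential Equations 20 (1976) 150–186, §§2–3 (escape is definitive beyond a
critical separation); D. Saari, Trans. AMS 156 (1971) 219–240.
-/

noncomputable section

set_option linter.dupNamespace false

open Filter Topology Set MeasureTheory intervalIntegral RealInnerProductSpace
open scoped Topology InnerProductSpace

namespace Summit.FinalStateConjecture.FinalStateConjecture.Theorems.SublinearIsFree.Endgame

open Literature.Geometry.Lorentzian

/-! ### Pointwise bounds for the impulse integrand -/

/-- `r^{3/2} = r√r` for `r ≥ 0`. [folklore] -/
theorem rpow_three_halves_eq {r : ℝ} (hr : 0 ≤ r) : r ^ (3 / 2 : ℝ) = r * √r := by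
  have : (3 / 2 : ℝ) = 1 + 1 / 2 := by norm_num
  rw [this, Real.rpow_add' hr (by norm_num), Real.rpow_one, Real.sqrt_eq_rpow]

/-- `min(a,b)^{-3/2} ≤ a^{-3/2} + b^{-3/2}` for `a, b > 0`. [folklore] -/
theorem inv_rpow_min_le {a b : ℝ} (ha : 0 < a) (hb : 0 < b) :
    ((min a b) ^ (3 / 2 : ℝ))⁻¹ ≤ (a ^ (3 / 2 : ℝ))⁻¹ + (b ^ (3 / 2 : ℝ))⁻¹ := by
  have h1 : 0 ≤ (a ^ (3 / 2 : ℝ))⁻¹ := inv_nonneg.mpr (Real.rpow_nonneg ha.le _)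
  have h2 : 0 ≤ (b ^ (3 / 2 : ℝ))⁻¹ := inv_nonneg.mpr (Real.rpow_nonneg hb.le _)
  rcases min_choice a b with h | h <;> rw [h] <;> linarith

/-- The separation bound `‖s‖ ≥ max(|x|, A) ≥ (|x| + A)/2` in impulse form:
`(‖s‖/4)^{-3/2} ≤ 8√8 · ((|x| + A)√(|x| + A))⁻¹`. [folklore] -/
theorem inv_rpow_div_four_le {S X A : ℝ} (hA : 0 < A) (hX : 0 ≤ X) (hXS : X ≤ S) (hAS : A ≤ S) :
    ((S / 4) ^ (3 / 2 : ℝ))⁻¹ ≤ 8 * √8 * ((X + A) * √(X + A))⁻¹ := by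
  have hq : 0 < X + A := by linarith
  have hS : 0 < S := hA.trans_le hAS
  have hle : (X + A) / 8 ≤ S / 4 := by linarith
  have h1 : ((X + A) / 8) ^ (3 / 2 : ℝ) ≤ (S / 4) ^ (3 / 2 : ℝ) :=
    Real.rpow_le_rpow (by positivity) hle (by norm_num)
  have h2 : 0 < ((X + A) / 8) ^ (3 / 2 : ℝ) := Real.rpow_pos_of_pos (by positivity) _
  calc ((S / 4) ^ (3 / 2 : ℝ))⁻¹ ≤ (((X + A) / 8) ^ (3 / 2 : ℝ))⁻¹ := inv_anti₀ h2 h1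
    _ = 8 * √8 * ((X + A) * √(X + A))⁻¹ := by
        rw [rpow_three_halves_eq (by positivity), Real.sqrt_div' _ (by norm_num : (0 : ℝ) ≤ 8)]
        have hs8 : √8 ≠ 0 := by positivity
        have hsq : √(X + A) ≠ 0 := (Real.sqrt_pos.mpr hq).ne'
        field_simp

/-! ### The impulse under the bootstrap -/

/-- IMPULSE ALONG A BALLISTIC STRETCH. On `[t₀, u]`, suppose the unit vector `n` and the relative velocity satisfy the
bootstrap `‖w(u′) − w(t₀)‖ ≤ W/8` with `w(t₀) = W • n`, `W > 0`, the slaving error is `‖ṡ − w‖ ≤ W/8`, and `‖s‖ ≥ A > 0`.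
Then the coordinate `x = ⟨s, n⟩` has speed `≥ W/2` and the two-body impulse integral obeys
`∫_{t₀}^{u} min(‖s‖/4, c₀u′)^{-3/2} du′ ≤ 64√8/(W√A) + 2c₀^{-3/2}t₀^{-1/2}`. [folklore] -/
theorem impulse_integral_le_of_bootstrap {s w : ℝ → E3} {n : E3} {W A c₀ t₀ u : ℝ} (hs : ContDiff ℝ 1 s)
    (hn : ‖n‖ = 1) (hW : 0 < W) (hA : 0 < A) (hc₀ : 0 < c₀) (ht₀ : 0 < t₀) (htu : t₀ ≤ u)
    (hw0 : w t₀ = W • n) (hboot : ∀ u' ∈ Icc t₀ u, ‖w u' - w t₀‖ ≤ W / 8)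
    (herr : ∀ u' ∈ Icc t₀ u, ‖deriv s u' - w u'‖ ≤ W / 8) (hfar : ∀ u' ∈ Icc t₀ u, A ≤ ‖s u'‖) :
    (∀ u' ∈ Icc t₀ u, W / 2 ≤ ⟪deriv s u', n⟫) ∧
    ∫ u' in t₀..u, ((min (‖s u'‖ / 4) (c₀ * u')) ^ (3 / 2 : ℝ))⁻¹ ≤
      64 * √8 / (W * √A) + 2 * (c₀ ^ (3 / 2 : ℝ))⁻¹ * (t₀ ^ (1 / 2 : ℝ))⁻¹ := by
  have hdiff : Differentiable ℝ s := hs.differentiable one_ne_zero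
  have hdcont : Continuous (deriv s) := hs.continuous_deriv le_rfl
  -- speed of the coordinate `x = ⟨s, n⟩`
  have hspeed : ∀ u' ∈ Icc t₀ u, W / 2 ≤ ⟪deriv s u', n⟫ := by
    intro u' hu'
    have hdec : deriv s u' = w t₀ + ((w u' - w t₀) + (deriv s u' - w u')) := by abel
    have h0 : ⟪w t₀, n⟫ = W := by
      rw [hw0, real_inner_smul_left, real_inner_self_eq_norm_sq, hn]; ring
    rw [hdec, inner_add_left, inner_add_left, h0]
    have h1 : |⟪w u' - w t₀, n⟫| ≤ W / 8 := by
      calc |⟪w u' - w t₀, n⟫| ≤ ‖w u' - w t₀‖ * ‖n‖ := abs_real_inner_le_norm _ _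
        _ ≤ W / 8 := by rw [hn, mul_one]; exact hboot u' hu'
    have h2 : |⟪deriv s u' - w u', n⟫| ≤ W / 8 := by
      calc |⟪deriv s u' - w u', n⟫| ≤ ‖deriv s u' - w u'‖ * ‖n‖ := abs_real_inner_le_norm _ _
        _ ≤ W / 8 := by rw [hn, mul_one]; exact herr u' hu'
    have h1' := neg_abs_le ⟪w u' - w t₀, n⟫
    have h2' := neg_abs_le ⟪deriv s u' - w u', n⟫
    linarith
  refine ⟨hspeed, ?_⟩
  -- the coordinate and its derivative
  set x : ℝ → ℝ := fun u' ↦ ⟪s u', n⟫ with hx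
  set x' : ℝ → ℝ := fun u' ↦ ⟪deriv s u', n⟫ with hx'
  have hxd : ∀ u', HasDerivAt x (x' u') u' := fun u' ↦ by
    have h := HasDerivAt.inner ℝ (hdiff u').hasDerivAt (hasDerivAt_const u' n)
    simpa [hx, hx'] using h
  have hx'cont : Continuous x' := hdcont.inner continuous_const
  have hxabs : ∀ u', |x u'| ≤ ‖s u'‖ := fun u' ↦ by
    calc |x u'| ≤ ‖s u'‖ * ‖n‖ := abs_real_inner_le_norm _ _
      _ = ‖s u'‖ := by rw [hn, mul_one]
  -- pointwise domination of the integrand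
  have hdom : ∀ u' ∈ Icc t₀ u, ((min (‖s u'‖ / 4) (c₀ * u')) ^ (3 / 2 : ℝ))⁻¹ ≤
      8 * √8 * ((|x u'| + A) * √(|x u'| + A))⁻¹ + ((c₀ * u') ^ (3 / 2 : ℝ))⁻¹ := by
    intro u' hu'
    have hS : 0 < ‖s u'‖ := hA.trans_le (hfar u' hu')
    have hcu : 0 < c₀ * u' := mul_pos hc₀ (ht₀.trans_le hu'.1)
    calc ((min (‖s u'‖ / 4) (c₀ * u')) ^ (3 / 2 : ℝ))⁻¹
        ≤ ((‖s u'‖ / 4) ^ (3 / 2 : ℝ))⁻¹ + ((c₀ * u') ^ (3 / 2 : ℝ))⁻¹ := inv_rpow_min_le (by positivity) hcu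
      _ ≤ 8 * √8 * ((|x u'| + A) * √(|x u'| + A))⁻¹ + ((c₀ * u') ^ (3 / 2 : ℝ))⁻¹ := by
          have := inv_rpow_div_four_le hA (abs_nonneg (x u')) (hxabs u') (hfar u' hu')
          linarith
  -- continuity of both sides on `[t₀, u]`
  have hscont : Continuous fun u' ↦ ‖s u'‖ := hdiff.continuous.norm
  have hLcont : ContinuousOn (fun u' ↦ ((min (‖s u'‖ / 4) (c₀ * u')) ^ (3 / 2 : ℝ))⁻¹) (Icc t₀ u) := by
    have hm : ContinuousOn (fun u' ↦ min (‖s u'‖ / 4) (c₀ * u')) (Icc t₀ u) :=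
      ((hscont.div_const 4).min (continuous_const.mul continuous_id)).continuousOn
    have hmpos : ∀ u' ∈ Icc t₀ u, 0 < min (‖s u'‖ / 4) (c₀ * u') := fun u' hu' ↦
      lt_min (by linarith [hA.trans_le (hfar u' hu')]) (mul_pos hc₀ (ht₀.trans_le hu'.1))
    refine (hm.rpow_const fun u' hu' ↦ Or.inl (hmpos u' hu').ne').inv₀ fun u' hu' ↦ ?_
    exact (Real.rpow_pos_of_pos (hmpos u' hu') _).ne'
  have hq : ∀ u', 0 < |x u'| + A := fun u' ↦ by positivity
  have hR1cont : ContinuousOn (fun u' ↦ 8 * √8 * ((|x u'| + A) * √(|x u'| + A))⁻¹) (Icc t₀ u) := by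
    have hxc : Continuous x := hdiff.continuous.inner continuous_const
    have hc : Continuous fun u' ↦ |x u'| + A := hxc.abs.add continuous_const
    refine ((hc.mul hc.sqrt).continuousOn.inv₀ fun u' _ ↦ ?_).const_smul (8 * √8) |>.congr fun u' _ ↦ by
      simp [smul_eq_mul]
    exact (mul_pos (hq u') (Real.sqrt_pos.mpr (hq u'))).ne'
  have hR2cont : ContinuousOn (fun u' ↦ ((c₀ * u') ^ (3 / 2 : ℝ))⁻¹) (Icc t₀ u) := by
    refine ContinuousOn.inv₀ ?_ fun u' hu' ↦ (Real.rpow_pos_of_pos (mul_pos hc₀ (ht₀.trans_le hu'.1)) _).ne'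
    exact (continuousOn_const.mul continuousOn_id).rpow_const fun u' hu' ↦
      Or.inl (mul_pos hc₀ (ht₀.trans_le hu'.1)).ne'
  -- integrate
  have hI1 : ∫ u' in t₀..u, 8 * √8 * ((|x u'| + A) * √(|x u'| + A))⁻¹ ≤ 8 * √8 * (8 / (W * √A)) := by
    rw [intervalIntegral.integral_const_mul]
    refine mul_le_mul_of_nonneg_left ?_ (by positivity)
    exact integral_ballistic_le htu hW hA (fun u' _ ↦ hxd u') hx'cont.continuousOn hspeed
  have hI2 : ∫ u' in t₀..u, ((c₀ * u') ^ (3 / 2 : ℝ))⁻¹ ≤ 2 * (c₀ ^ (3 / 2 : ℝ))⁻¹ * (t₀ ^ (1 / 2 : ℝ))⁻¹ :=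
    integral_inv_rpow_three_halves_mul_le hc₀ ht₀ htu
  calc ∫ u' in t₀..u, ((min (‖s u'‖ / 4) (c₀ * u')) ^ (3 / 2 : ℝ))⁻¹
      ≤ ∫ u' in t₀..u, (8 * √8 * ((|x u'| + A) * √(|x u'| + A))⁻¹ + ((c₀ * u') ^ (3 / 2 : ℝ))⁻¹) :=
        intervalIntegral.integral_mono_on htu (hLcont.intervalIntegrable_of_Icc htu)
          ((hR1cont.add hR2cont).intervalIntegrable_of_Icc htu) hdom
    _ = (∫ u' in t₀..u, 8 * √8 * ((|x u'| + A) * √(|x u'| + A))⁻¹) +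
          ∫ u' in t₀..u, ((c₀ * u') ^ (3 / 2 : ℝ))⁻¹ :=
        intervalIntegral.integral_add (hR1cont.intervalIntegrable_of_Icc htu)
          (hR2cont.intervalIntegrable_of_Icc htu)
    _ ≤ 8 * √8 * (8 / (W * √A)) + 2 * (c₀ ^ (3 / 2 : ℝ))⁻¹ * (t₀ ^ (1 / 2 : ℝ))⁻¹ := add_le_add hI1 hI2
    _ = 64 * √8 / (W * √A) + 2 * (c₀ ^ (3 / 2 : ℝ))⁻¹ * (t₀ ^ (1 / 2 : ℝ))⁻¹ := by ring

/-! ### The dichotomy -/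

/-- `√8 ≤ 3`. [folklore] -/
theorem sqrt_eight_le_three : √8 ≤ (3 : ℝ) := by
  have h : √8 ≤ √9 := Real.sqrt_le_sqrt (by norm_num)
  have h9 : √9 = (3 : ℝ) := by
    rw [show (9 : ℝ) = 3 ^ 2 by norm_num, Real.sqrt_sq (by norm_num)]
  linarith

/-- THE BALLISTIC DICHOTOMY for a pair. See the module docstring. [folklore] -/
theorem ballistic_dichotomy {s w : ℝ → E3} {C c₀ T₀ : ℝ} {ζ : ℝ → ℝ}
    (hs : ContDiff ℝ 1 s) (hw : Continuous w)
    (he : Tendsto (fun t ↦ deriv s t - w t) atTop (𝓝 0))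
    (hd : Tendsto (fun t ↦ ‖s t‖) atTop atTop)
    (hc₀ : 0 < c₀) (hT₀ : 0 < T₀) (hζ : Tendsto ζ atTop (𝓝 0))
    (himp : ∀ t₁ t₂, T₀ ≤ t₁ → t₁ ≤ t₂ → ‖w t₂ - w t₁‖ ≤
        C * (∫ u in t₁..t₂, ((min (‖s u‖ / 4) (c₀ * u)) ^ (3 / 2 : ℝ))⁻¹) + ζ t₁ + ζ t₂) :
    (∃ σ : ℝ, 0 < σ ∧ ∀ᶠ t in atTop, σ * t ≤ ‖s t‖) ∨ Tendsto w atTop (𝓝 0) := by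
  by_cases htw : Tendsto w atTop (𝓝 0)
  · exact Or.inr htw
  left
  have hdiff : Differentiable ℝ s := hs.differentiable one_ne_zero
  -- a velocity scale `ε` exceeded frequently
  obtain ⟨ε, hε, hfreq⟩ : ∃ ε : ℝ, 0 < ε ∧ ∃ᶠ t in atTop, ε ≤ ‖w t‖ := by
    rw [Metric.tendsto_nhds] at htw
    push Not at htw
    obtain ⟨ε, hε, h⟩ := htw
    refine ⟨ε, hε, ?_⟩
    exact h.mono fun t ht ↦ by simpa [dist_zero_right] using ht
  -- the separation scale `A(ε, C)`
  set A : ℝ := (6144 * |C| / ε ^ 2 + 1) ^ 2 with hA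
  have hA0 : 0 ≤ 6144 * |C| / ε ^ 2 := by positivity
  have hApos : 0 < A := by positivity
  have hsqrtA : √A = 6144 * |C| / ε ^ 2 + 1 := Real.sqrt_sq (by positivity)
  -- eventual smallness
  have hev1 : ∀ᶠ t in atTop, A ≤ ‖s t‖ := hd.eventually_ge_atTop A
  have hev2 : ∀ᶠ t in atTop, ζ t ≤ ε / 64 := hζ.eventually (eventually_le_nhds (by positivity))
  have hev3 : ∀ᶠ t in atTop, ‖deriv s t - w t‖ ≤ ε / 8 := by
    have h := he.norm
    rw [norm_zero] at h
    exact h.eventually (eventually_le_nhds (by positivity))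
  have hev4 : ∀ᶠ t : ℝ in atTop, |C| * (2 * (c₀ ^ (3 / 2 : ℝ))⁻¹ * (t ^ (1 / 2 : ℝ))⁻¹) ≤ ε / 32 := by
    have h := (tendsto_inv_rpow_half.const_mul (2 * (c₀ ^ (3 / 2 : ℝ))⁻¹)).const_mul |C|
    rw [mul_zero, mul_zero] at h
    exact h.eventually (eventually_le_nhds (by positivity))
  obtain ⟨T₁, hT₁⟩ := eventually_atTop.mp (hev1.and (hev2.and (hev3.and hev4)))
  set T : ℝ := max (max T₀ T₁) 1 with hTdef
  have hTT₀ : T₀ ≤ T := (le_max_left _ _).trans (le_max_left _ _)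
  have hTT₁ : T₁ ≤ T := (le_max_right _ _).trans (le_max_left _ _)
  have hT1 : 1 ≤ T := le_max_right _ _
  -- a late time with a fast relative velocity
  obtain ⟨t₀, ht₀T, ht₀w⟩ := hfreq.forall_exists_of_atTop T
  have ht₀pos : 0 < t₀ := by linarith
  have hfacts : ∀ t, t₀ ≤ t → A ≤ ‖s t‖ ∧ ζ t ≤ ε / 64 ∧ ‖deriv s t - w t‖ ≤ ε / 8 ∧
      |C| * (2 * (c₀ ^ (3 / 2 : ℝ))⁻¹ * (t ^ (1 / 2 : ℝ))⁻¹) ≤ ε / 32 := fun t ht ↦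
    hT₁ t (hTT₁.trans (ht₀T.trans ht))
  set W : ℝ := ‖w t₀‖ with hWdef
  have hWε : ε ≤ W := ht₀w
  have hW : 0 < W := hε.trans_le hWε
  set n : E3 := W⁻¹ • w t₀ with hndef
  have hn : ‖n‖ = 1 := by
    rw [hndef, norm_smul, norm_inv, Real.norm_eq_abs, abs_of_pos hW, inv_mul_cancel₀ hW.ne']
  have hw0 : w t₀ = W • n := by
    rw [hndef, smul_smul, mul_inv_cancel₀ hW.ne', one_smul]
  -- √8 ≤ 3 and the choice of `A`
  have hCA : |C| * (64 * √8 / (W * √A)) ≤ W / 32 := by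
    rw [mul_div_assoc', div_le_div_iff₀ (by positivity) (by norm_num)]
    -- `|C| * (64 √8) * 32 ≤ W * (W * √A)`
    have h1 : |C| * (64 * √8) * 32 ≤ 6144 * |C| := by
      nlinarith [sqrt_eight_le_three, abs_nonneg C, Real.sqrt_nonneg 8]
    have h2 : 6144 * |C| ≤ ε ^ 2 * √A := by
      rw [hsqrtA, mul_add, mul_div_cancel₀ _ (by positivity)]
      nlinarith
    have h3 : ε ^ 2 * √A ≤ W * (W * √A) := by
      have : ε ^ 2 ≤ W ^ 2 := pow_le_pow_left₀ hε.le hWε 2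
      nlinarith [Real.sqrt_nonneg A]
    linarith
  -- KEY: under the bootstrap on `[t₀, u]` the impulse received is `≤ 3W/32`
  have key : ∀ u, t₀ ≤ u → (∀ u' ∈ Icc t₀ u, ‖w u' - w t₀‖ ≤ W / 8) → ‖w u - w t₀‖ ≤ 3 * W / 32 := by
    intro u htu hboot
    have herr : ∀ u' ∈ Icc t₀ u, ‖deriv s u' - w u'‖ ≤ W / 8 := fun u' hu' ↦ by
      linarith [(hfacts u' hu'.1).2.2.1]
    have hfar : ∀ u' ∈ Icc t₀ u, A ≤ ‖s u'‖ := fun u' hu' ↦ (hfacts u' hu'.1).1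
    obtain ⟨-, hint⟩ := impulse_integral_le_of_bootstrap hs hn hW hApos hc₀ ht₀pos htu hw0 hboot herr hfar
    have h := himp t₀ u (hTT₀.trans ht₀T) htu
    have hInn : 0 ≤ ∫ u' in t₀..u, ((min (‖s u'‖ / 4) (c₀ * u')) ^ (3 / 2 : ℝ))⁻¹ := by
      refine intervalIntegral.integral_nonneg htu fun u' hu' ↦ inv_nonneg.mpr (Real.rpow_nonneg ?_ _)
      exact le_min (by linarith [norm_nonneg (s u')]) (mul_pos hc₀ (ht₀pos.trans_le hu'.1)).le
    calc ‖w u - w t₀‖ ≤ C * (∫ u' in t₀..u, ((min (‖s u'‖ / 4) (c₀ * u')) ^ (3 / 2 : ℝ))⁻¹) + ζ t₀ + ζ u := h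
      _ ≤ |C| * (∫ u' in t₀..u, ((min (‖s u'‖ / 4) (c₀ * u')) ^ (3 / 2 : ℝ))⁻¹) + ε / 64 + ε / 64 := by
          have e1 := mul_le_mul_of_nonneg_right (le_abs_self C) hInn
          linarith [(hfacts t₀ le_rfl).2.1, (hfacts u htu).2.1]
      _ ≤ |C| * (64 * √8 / (W * √A) + 2 * (c₀ ^ (3 / 2 : ℝ))⁻¹ * (t₀ ^ (1 / 2 : ℝ))⁻¹) + ε / 64 + ε / 64 := by
          have e2 := mul_le_mul_of_nonneg_left hint (abs_nonneg C)
          linarith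
      _ = |C| * (64 * √8 / (W * √A)) + |C| * (2 * (c₀ ^ (3 / 2 : ℝ))⁻¹ * (t₀ ^ (1 / 2 : ℝ))⁻¹) + ε / 32 := by
          ring
      _ ≤ W / 32 + ε / 32 + ε / 32 := by linarith [(hfacts t₀ le_rfl).2.2.2, hCA]
      _ ≤ 3 * W / 32 := by linarith
  -- the bootstrap holds for all `u ≥ t₀` (first-exit-time argument)
  have hall : ∀ u, t₀ ≤ u → ‖w u - w t₀‖ ≤ W / 8 := by
    by_contra hbad
    push Not at hbad
    set B : Set ℝ := {u | t₀ ≤ u ∧ W / 8 < ‖w u - w t₀‖} with hB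
    have hBne : B.Nonempty := by obtain ⟨u, hu, hu'⟩ := hbad; exact ⟨u, hu, hu'⟩
    have hBbdd : BddBelow B := ⟨t₀, fun u hu ↦ hu.1⟩
    set u₁ : ℝ := sInf B with hu₁def
    have hu₁ : t₀ ≤ u₁ := le_csInf hBne fun u hu ↦ hu.1
    have hgood : ∀ u ∈ Ico t₀ u₁, ‖w u - w t₀‖ ≤ W / 8 := fun u hu ↦ by
      by_contra h
      push Not at h
      have : u₁ ≤ u := csInf_le hBbdd ⟨hu.1, h⟩
      linarith [hu.2]
    have hkey : ∀ u ∈ Ico t₀ u₁, ‖w u - w t₀‖ ≤ 3 * W / 32 := fun u hu ↦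
      key u hu.1 fun u' hu' ↦ hgood u' ⟨hu'.1, hu'.2.trans_lt hu.2⟩
    have hcont : Continuous fun u ↦ ‖w u - w t₀‖ := (hw.sub continuous_const).norm
    have hu₁val : ‖w u₁ - w t₀‖ ≤ 3 * W / 32 := by
      rcases eq_or_lt_of_le hu₁ with h | h
      · rw [← h, sub_self, norm_zero]; positivity
      · have htend : Tendsto (fun u ↦ ‖w u - w t₀‖) (𝓝[<] u₁) (𝓝 ‖w u₁ - w t₀‖) :=
          hcont.continuousAt.tendsto.mono_left nhdsWithin_le_nhds
        refine le_of_tendsto htend ?_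
        have hmem : Ico t₀ u₁ ∈ 𝓝[<] u₁ := Ico_mem_nhdsLT h
        exact mem_of_superset hmem fun u hu ↦ hkey u hu
    have hnear : ∀ᶠ u in 𝓝 u₁, ‖w u - w t₀‖ < W / 8 :=
      hcont.continuousAt.eventually_lt continuousAt_const (by linarith)
    obtain ⟨δ, hδ, hball⟩ := Metric.eventually_nhds_iff.mp hnear
    have hcontra : u₁ + δ / 2 ≤ u₁ := by
      rw [hu₁def]
      refine le_csInf hBne fun b hb ↦ ?_
      by_contra hlt
      push Not at hlt
      have hb1 : sInf B ≤ b := csInf_le hBbdd hb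
      have hdist : dist b (sInf B) < δ := by
        rw [Real.dist_eq, abs_of_nonneg (by linarith)]; linarith
      exact absurd (hball hdist) (not_lt.mpr hb.2.le)
    linarith
  -- consequence: the coordinate `x = ⟨s, n⟩` grows linearly, and so does `‖s‖`
  set x : ℝ → ℝ := fun u ↦ ⟪s u, n⟫ with hx
  have hxd : ∀ u, HasDerivAt x ⟪deriv s u, n⟫ u := fun u ↦ by
    have h := HasDerivAt.inner ℝ (hdiff u).hasDerivAt (hasDerivAt_const u n)
    simpa [hx] using h
  have hspeed : ∀ u, t₀ ≤ u → W / 2 ≤ ⟪deriv s u, n⟫ := fun u hu ↦ by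
    have herr : ∀ u' ∈ Icc t₀ u, ‖deriv s u' - w u'‖ ≤ W / 8 := fun u' hu' ↦ by
      linarith [(hfacts u' hu'.1).2.2.1]
    have hfar : ∀ u' ∈ Icc t₀ u, A ≤ ‖s u'‖ := fun u' hu' ↦ (hfacts u' hu'.1).1
    exact (impulse_integral_le_of_bootstrap hs hn hW hApos hc₀ ht₀pos hu hw0
      (fun u' hu' ↦ hall u' hu'.1) herr hfar).1 u (right_mem_Icc.mpr hu)
  have hgrow : ∀ u, t₀ ≤ u → W / 2 * (u - t₀) ≤ x u - x t₀ := by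
    intro u hu
    have hconv : Convex ℝ (Ici t₀) := convex_Ici t₀
    have hcontx : ContinuousOn x (Ici t₀) := fun u _ ↦ (hxd u).continuousAt.continuousWithinAt
    have hdx : DifferentiableOn ℝ x (interior (Ici t₀)) := fun u _ ↦
      (hxd u).differentiableAt.differentiableWithinAt
    refine hconv.mul_sub_le_image_sub_of_le_deriv hcontx hdx (fun u' hu' ↦ ?_) t₀ self_mem_Ici u hu hu
    rw [interior_Ici] at hu'
    rw [(hxd u').deriv]
    exact hspeed u' (le_of_lt hu')
  have hxabs : ∀ u, x u ≤ ‖s u‖ := fun u ↦ by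
    calc x u ≤ |x u| := le_abs_self _
      _ ≤ ‖s u‖ * ‖n‖ := abs_real_inner_le_norm _ _
      _ = ‖s u‖ := by rw [hn, mul_one]
  have hx0 : -‖s t₀‖ ≤ x t₀ := by
    have h1 : |x t₀| ≤ ‖s t₀‖ := by
      calc |x t₀| ≤ ‖s t₀‖ * ‖n‖ := abs_real_inner_le_norm _ _
        _ = ‖s t₀‖ := by rw [hn, mul_one]
    linarith [neg_abs_le (x t₀)]
  refine ⟨W / 4, by positivity, ?_⟩
  filter_upwards [eventually_ge_atTop (max t₀ (2 * t₀ + 4 * ‖s t₀‖ / W))] with u hu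
  have hu1 : t₀ ≤ u := (le_max_left _ _).trans hu
  have hu2 : 2 * t₀ + 4 * ‖s t₀‖ / W ≤ u := (le_max_right _ _).trans hu
  have hg := hgrow u hu1
  have hsW : 4 * ‖s t₀‖ / W * W = 4 * ‖s t₀‖ := div_mul_cancel₀ _ hW.ne'
  nlinarith [hxabs u, hx0, hsW, hW]

/-- Registered helper form (verbatim signature) of `ballistic_dichotomy`. [folklore] -/
theorem endgame_ballistic_dichotomy : open Literature.Geometry.Lorentzian Filter Topology in ∀ (s w : ℝ → E3) (C c₀ T₀ : ℝ) (ζ : ℝ → ℝ), ContDiff ℝ 1 s → Continuous w → Tendsto (fun t ↦ deriv s t - w t) atTop (𝓝 0) → Tendsto (fun t ↦ ‖s t‖) atTop atTop → 0 < c₀ → 0 < T₀ → Tendsto ζ atTop (𝓝 0) → (∀ t₁ t₂, T₀ ≤ t₁ → t₁ ≤ t₂ → ‖w t₂ - w t₁‖ ≤ C * (∫ u in t₁..t₂, ((min (‖s u‖ / 4) (c₀ * u)) ^ (3 / 2 : ℝ))⁻¹) + ζ t₁ + ζ t₂) → (∃ σ : ℝ, 0 < σ ∧ ∀ᶠ t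 in atTop, σ * t ≤ ‖s t‖) ∨ Tendsto w atTop (𝓝 0) :=
  fun _ _ _ _ _ _ hs hw he hd hc₀ hT₀ hζ himp ↦ ballistic_dichotomy hs hw he hd hc₀ hT₀ hζ himp

end Summit.FinalStateConjecture.FinalStateConjecture.Theorems.SublinearIsFree.Endgame

end
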